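import Literature.NumberTheory.Automorphic.Liu2021.Def411WeilCarriersChiUnitary
import Literature.NumberTheory.Automorphic.UnitaryGroupFinAdelicCenterLocal
import Literature.NumberTheory.Automorphic.UnitaryGroupAdelicProduct
import Literature.RepresentationTheory.CompactGroups.CharacterCompleteness
import Mathlib.Analysis.Complex.Circle
import HarnessLib

/-!
# [Liu2021, Def. 4.11] `χ : E¹\(𝔸_E^∞)¹ → ℂˣ` READ AS AN AUTOMORPHIC CHARACTER OF `[U(W)] = U(W)(𝔸_F) ⧸ U(W)(F)`,
# trivial at the archimedean places

Y. Liu, *Fourier–Jacobi cycles and arithmetic relative trace formula*, Camb. J. Math. **9** (2021), Def. 4.11 (FJcycle.tex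
l. 2090): «an automorphic character `χ = ⊗ χ_v : E¹\(𝔸_E^∞)¹ → ℂˣ` (whose value is necessarily in `ℂ¹`)»; App. D §D.1 Step 3
(l. 5221) (the torus `U(W) = E¹` of the hermitian line `W` acts through `χ`); proof of Prop. 4.13 l. 2145 («Conversely …»: the
theta lift `∫_{[U(W)]} θ(g, h) χ(h) dh` of that character).

Topic `NumberTheory/Automorphic/Liu2021`; namespace `Literature.NumberTheory.Automorphic.Liu2021.Def411WeilCarriers`.  KERNEL
junction (definitions with bodies + theorems; nothing asserted): the tree types Liu's `χ` on the FINITE-adelic norm-one torus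
(`Chi F E c = {χ : UnitaryGroup.finAdelicOne F E c →* ℂˣ // IsAutomorphicOneChar …}`, `Def411WeilCarriers` §2) and moves it to
the finite-adelic points of the line's unitary group as `lineChar a χ : U(J_W a)(𝔸_{F,f}) →* ℂˣ`; the theta lift of the tree
(`Weil1964.ThetaKernelDatum.thetaLift`, [FleigEtAl2018, (12.37)]) integrates against continuous functions on the FULL adelic
quotient `U(J_W a)(𝔸_F) ⧸ U(J_W a)(F)`, and the character currency there is `PontryaginDual (… ⧸ …)` read through
`CompactGroups.charCM` (`GelbartRogawski1991/UnitaryDualPairThetaLiftCharacterCovariance`, `Li1992/RallisInnerProductCharacterLift`).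
This file is the junction between the two:

* §1 `lineChar_eq_apply_finAdelicCenterInv`, `continuous_lineChar` — `χ_W = χ ∘ det` on `1 × 1` matrices (tree
  `UnitaryGroup.finAdelicCenterInv`), hence continuous when `χ` is;
* §2 **`adelicLineChar a χ : U(J_W a)(𝔸_F) →* ℂˣ := χ_W ∘ (h ↦ h_f)`** (`UnitaryGroup.finPart`): the adelic character with
  finite part `χ_W` and TRIVIAL archimedean part (`adelicLineChar_archToAdelic`, `adelicLineChar_finAdelicToAdelic`); it is
  continuous (`continuous_adelicLineChar`), kills the rational points `U(J_W a)(F)` when `χ` is automorphic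
  (**`adelicLineChar_toAdelic`**: the finite component of a rational point `γ` is the principal finite idèle `(det γ)` times
  `1_W`, killed by `IsAutomorphicOneChar`), and is unitary for `[E : F] = 2`, `c ≠ 1` (`norm_adelicLineChar`, from ★
  `norm_lineChar_apply_eq_one`);
* §3 `normal_range_toAdelic_line` (`U(J)(𝔸_F)` is commutative for a `1 × 1` form), and **`chiQuot a χ : PontryaginDual
  (U(J_W a)(𝔸_F) ⧸ U(J_W a)(F))`** — the descended continuous unitary character — with **`coe_chiQuot_mk :
  chiQuot a χ [h] = χ_W(h_f)`**, `charCM_chiQuot_mk`, and the archimedean triviality `chiQuot_mk_archToAdelic = 1`.  This is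
  the `χ̃` with `χ_∞ = 1`, `w_f = conj ∘ χ_W` consumed by `Li1992/ThetaLiftCharacterArchFinReduction`
  (`thetaLift_charCM_tmul_ne_zero_of_finCoeff_ne_zero`, hypothesis `hχw`: here `conj_coe_chiQuot_mk`).

## Mathlib / tree search
Tree: `Chi`, `IsAutomorphicOneChar`, `lineChar`, `lineCenterEquiv` (`Def411WeilCarriers`); `norm_lineChar_apply_eq_one`
(`Def411WeilCarriersChiUnitary`); `finAdelicCenterInv`, `continuous_finAdelicCenterInv`, `finAdelicCenter_finAdelicCenterInv`
(`UnitaryGroupFinAdelicCenterLocal`); `archPart`/`finPart`/`archToAdelic`/`finAdelicToAdelic` (`UnitaryGroupAdelicProduct`); the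
adelic-torus analogue `quotChar`/`lineCharOf` (`UnitaryGroupAdelicCharactersArchType`, currency `relNormOneIdeles ⧸ relNormOneRat`,
characters of the FULL adelic torus — not Liu's finite-adelic `Chi`).  No prior `PontryaginDual` reading of `Chi`
(`lean search 'PontryaginDual.*lineChar|Chi.*PontryaginDual'` empty).  Mathlib: `QuotientGroup.lift`, `QuotientGroup.isQuotientMap_mk`,
`ContinuousMonoidHom`, `Circle`.

## References
* [Liu2021] Y. Liu, Camb. J. Math. 9 (2021), Def. 4.11 (l. 2090), App. D §D.1 Step 3 (l. 5221), proof of Prop. 4.13 (l. 2145).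
* [FleigEtAl2018] P. Fleig, H. Gustafsson, A. Kleinschmidt, D. Persson, CUP (2018), §12.3 Def. 12.5 (12.37) p. 296.
* [BorelJacquet1979] A. Borel, H. Jacquet, Proc. Symp. Pure Math. 33 (1979), §4.1 (`G(𝔸) = G_∞ × G(𝔸_f)`).
* [Mok2014] C. P. Mok, Mem. AMS 235 (2015), §1 Notation p. 5 (the centre `U_{E/F}(1)` of `U_{E/F}(N)`).
-/

set_option autoImplicit false

noncomputable section

open NumberField IsDedekindDomain
open scoped ComplexConjugate
open Literature.RepresentationTheory.CompactGroups

namespace Literature.NumberTheory.Automorphic.Liu2021.Def411WeilCarriers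

variable (F E : Type) [Field F] [NumberField F] [Field E] [NumberField E] [Algebra F E] (c : E ≃ₐ[F] E)

/-! ## §1 `χ_W = χ ∘ det` on the line, and its continuity -/

omit [NumberField F] in
/-- `(lineCenterEquiv a)⁻¹ = det` on `U(J_W a)(𝔸_{F,f})` (`1 × 1` matrices; tree `finAdelicCenterInv`). [cite: Mok2014, §1 Notation p. 5] -/
theorem lineCenterEquiv_symm_apply (a : Fˣ) (g : UnitaryGroup.finAdelic F E c 1 (JW F E a)) :
    (lineCenterEquiv F E c a).symm g = UnitaryGroup.finAdelicCenterInv F E c (JW F E a) (JW_apply_ne_zero F E a) g := by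
  apply (lineCenterEquiv F E c a).injective
  rw [MulEquiv.apply_symm_apply, lineCenterEquiv_apply, UnitaryGroup.finAdelicCenter_finAdelicCenterInv]

omit [NumberField F] in
/-- **`χ_W(g) = χ(det g)`**. [cite: Liu2021, App. D §D.1 Step 3 (l. 5221)] -/
theorem lineChar_eq_apply_finAdelicCenterInv (a : Fˣ) (χ : UnitaryGroup.finAdelicOne F E c →* ℂˣ)
    (g : UnitaryGroup.finAdelic F E c 1 (JW F E a)) :
    lineChar F E c a χ g = χ (UnitaryGroup.finAdelicCenterInv F E c (JW F E a) (JW_apply_ne_zero F E a) g) := by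
  show χ ((lineCenterEquiv F E c a).symm g) = _
  rw [lineCenterEquiv_symm_apply]

omit [NumberField F] in
/-- `χ_W` is continuous when `χ` is. [cite: Liu2021, Def. 4.11 (l. 2090)] -/
theorem continuous_lineChar (a : Fˣ) {χ : UnitaryGroup.finAdelicOne F E c →* ℂˣ} (hχ : Continuous χ) :
    Continuous (lineChar F E c a χ) := by
  have h : (lineChar F E c a χ : UnitaryGroup.finAdelic F E c 1 (JW F E a) → ℂˣ) =
      fun g => χ (UnitaryGroup.finAdelicCenterInv F E c (JW F E a) (JW_apply_ne_zero F E a) g) :=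
    funext (lineChar_eq_apply_finAdelicCenterInv F E c a χ)
  rw [h]
  exact hχ.comp (UnitaryGroup.continuous_finAdelicCenterInv F E c (JW F E a) (JW_apply_ne_zero F E a))

/-! ## §2 The adelic character `h ↦ χ_W(h_f)`: trivial at `∞`, automorphic, unitary -/

/-- **`χ` as a character of the ADELIC points `U(J_W a)(𝔸_F)`**: `h ↦ χ_W(h_f)` (finite part through `UnitaryGroup.finPart`,
archimedean part ignored) — the adelic automorphic character with finite component Liu's `χ` and trivial archimedean component.
[cite: Liu2021, Def. 4.11 (l. 2090); App. D §D.1 Step 3 (l. 5221)] [cite: BorelJacquet1979, §4.1] -/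
def adelicLineChar (a : Fˣ) (χ : UnitaryGroup.finAdelicOne F E c →* ℂˣ) :
    UnitaryGroup.adelic F E c 1 (JW F E a) →* ℂˣ :=
  (lineChar F E c a χ).comp (UnitaryGroup.finPart F E c 1 (JW F E a))

/-- `adelicLineChar a χ h = χ_W (h_f)`. [cite: Liu2021, App. D §D.1 Step 3 (l. 5221)] -/
theorem adelicLineChar_apply (a : Fˣ) (χ : UnitaryGroup.finAdelicOne F E c →* ℂˣ)
    (h : UnitaryGroup.adelic F E c 1 (JW F E a)) :
    adelicLineChar F E c a χ h = lineChar F E c a χ (UnitaryGroup.finPart F E c 1 (JW F E a) h) := rfl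

/-- **trivial archimedean part**: `adelicLineChar a χ (h_∞, 1) = 1`. [cite: BorelJacquet1979, §4.1] -/
@[simp] theorem adelicLineChar_archToAdelic (a : Fˣ) (χ : UnitaryGroup.finAdelicOne F E c →* ℂˣ)
    (x : UnitaryGroup.arch F E c 1 (JW F E a)) :
    adelicLineChar F E c a χ (UnitaryGroup.archToAdelic F E c 1 (JW F E a) x) = 1 := by
  rw [adelicLineChar_apply, UnitaryGroup.finPart_archToAdelic, map_one]

/-- **finite part `χ_W`**: `adelicLineChar a χ (1, h_f) = χ_W(h_f)`. [cite: Liu2021, App. D §D.1 Step 3 (l. 5221)] -/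
@[simp] theorem adelicLineChar_finAdelicToAdelic (a : Fˣ) (χ : UnitaryGroup.finAdelicOne F E c →* ℂˣ)
    (b : UnitaryGroup.finAdelic F E c 1 (JW F E a)) :
    adelicLineChar F E c a χ (UnitaryGroup.finAdelicToAdelic F E c 1 (JW F E a) b) = lineChar F E c a χ b := by
  rw [adelicLineChar_apply, UnitaryGroup.finPart_finAdelicToAdelic]

/-- `adelicLineChar a χ` is continuous when `χ` is. [cite: Liu2021, Def. 4.11 (l. 2090)] -/
theorem continuous_adelicLineChar (a : Fˣ) {χ : UnitaryGroup.finAdelicOne F E c →* ℂˣ} (hχ : Continuous χ) :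
    Continuous (adelicLineChar F E c a χ) :=
  (continuous_lineChar F E c a hχ).comp (UnitaryGroup.continuous_finPart F E c 1 (JW F E a))

/-- **the finite component of a rational point of the line is the principal finite idèle of its entry**:
`det ((γ)_f) = (γ₀₀)_f` in `U(1)(𝔸_{F,f})`. [cite: BorelJacquet1979, §4.1] [cite: Mok2014, §1 Notation p. 5] -/
theorem coe_finAdelicCenterInv_finPart_toAdelic (a : Fˣ) (γ : UnitaryGroup.rational F E c 1 (JW F E a)) :
    ((UnitaryGroup.finAdelicCenterInv F E c (JW F E a) (JW_apply_ne_zero F E a)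
        (UnitaryGroup.finPart F E c 1 (JW F E a) (UnitaryGroup.toAdelic F E c 1 (JW F E a) γ)) :
          UnitaryGroup.finAdelicOne F E c) : (FiniteAdeleRing (𝓞 E) E)ˣ) =
      Units.map (algebraMap E (FiniteAdeleRing (𝓞 E) E)).toMonoidHom
        (Matrix.GeneralLinearGroup.det (γ : GL (Fin 1) E)) := by
  refine Units.ext ?_
  rw [UnitaryGroup.coe_finAdelicCenterInv, Matrix.GeneralLinearGroup.val_det_apply, Matrix.det_fin_one, Units.coe_map]
  change _ = algebraMap E (FiniteAdeleRing (𝓞 E) E) ((Matrix.GeneralLinearGroup.det (γ : GL (Fin 1) E) : Eˣ) : E)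
  rw [Matrix.GeneralLinearGroup.val_det_apply, Matrix.det_fin_one]
  rfl

/-- **`adelicLineChar a χ` kills the rational points** `U(J_W a)(F)` when `χ` is automorphic (trivial on `E¹`): the finite
part of `γ ∈ U(J_W a)(F)` is `(det γ)_f · 1_W` with `det γ ∈ E¹`. [cite: Liu2021, Def. 4.11 (l. 2090)] [cite: Mok2014, §1 Notation p. 5] -/
theorem adelicLineChar_toAdelic (a : Fˣ) {χ : UnitaryGroup.finAdelicOne F E c →* ℂˣ} (hχ : IsAutomorphicOneChar F E c χ)
    (γ : UnitaryGroup.rational F E c 1 (JW F E a)) :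
    adelicLineChar F E c a χ (UnitaryGroup.toAdelic F E c 1 (JW F E a) γ) = 1 := by
  rw [adelicLineChar_apply, lineChar_eq_apply_finAdelicCenterInv]
  have hval := coe_finAdelicCenterInv_finPart_toAdelic F E c a γ
  have hx : Units.map (algebraMap E (FiniteAdeleRing (𝓞 E) E)).toMonoidHom
      (Matrix.GeneralLinearGroup.det (γ : GL (Fin 1) E)) ∈ UnitaryGroup.finAdelicOne F E c :=
    hval ▸ (UnitaryGroup.finAdelicCenterInv F E c (JW F E a) (JW_apply_ne_zero F E a) _).2
  have heq : UnitaryGroup.finAdelicCenterInv F E c (JW F E a) (JW_apply_ne_zero F E a)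
      (UnitaryGroup.finPart F E c 1 (JW F E a) (UnitaryGroup.toAdelic F E c 1 (JW F E a) γ)) = ⟨_, hx⟩ :=
    Subtype.ext hval
  rw [heq]
  exact hχ.2 _ hx

/-- `adelicLineChar a χ` kills the subgroup `range toAdelic`. [cite: Liu2021, Def. 4.11 (l. 2090)] -/
theorem range_toAdelic_le_ker_adelicLineChar (a : Fˣ) {χ : UnitaryGroup.finAdelicOne F E c →* ℂˣ}
    (hχ : IsAutomorphicOneChar F E c χ) :
    (UnitaryGroup.toAdelic F E c 1 (JW F E a)).range ≤ (adelicLineChar F E c a χ).ker := by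
  rintro _ ⟨γ, rfl⟩
  exact adelicLineChar_toAdelic F E c a hχ γ

/-- **unitarity**: `‖adelicLineChar a χ h‖ = 1` for `χ ∈ Chi`, `[E : F] = 2`, `c ≠ 1` (★ `norm_lineChar_apply_eq_one`).
[cite: Liu2021, Def. 4.11 (l. 2090)] -/
theorem norm_adelicLineChar (h2 : Module.finrank F E = 2) (hc : c ≠ 1) (a : Fˣ) (χ : Chi F E c)
    (h : UnitaryGroup.adelic F E c 1 (JW F E a)) : ‖((adelicLineChar F E c a χ.1 h : ℂˣ) : ℂ)‖ = 1 :=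
  norm_lineChar_apply_eq_one F E c h2 hc a χ _

/-! ## §3 The descended character `χ̃ ∈ PontryaginDual [U(J_W a)]` -/

omit [NumberField F] in
/-- `U(J)(𝔸_F)` is commutative for a `1 × 1` form `J`. [cite: Mok2014, §1 Notation p. 5] -/
theorem adelic_line_mul_comm (J : Matrix (Fin 1) (Fin 1) E) (g m : UnitaryGroup.adelic F E c 1 J) : g * m = m * g := by
  refine Subtype.ext ?_
  show (g : GL (Fin 1) (AdeleRing (𝓞 E) E)) * m = m * g
  ext i j
  simp [Units.val_mul, Matrix.mul_apply, Subsingleton.elim i 0, Subsingleton.elim j 0, mul_comm]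

omit [NumberField F] in
/-- The rational points `U(J)(F)` of a line form a NORMAL subgroup of the (commutative) adelic points, so `[U(J)]` is a
compact abelian GROUP. [cite: Mok2014, §1 Notation p. 5] -/
theorem normal_range_toAdelic_line (J : Matrix (Fin 1) (Fin 1) E) : (UnitaryGroup.toAdelic F E c 1 J).range.Normal :=
  ⟨fun m hm g => by rwa [adelic_line_mul_comm F E c J g m, mul_inv_cancel_right]⟩

section Quot

variable (h2 : Module.finrank F E = 2) (hc : c ≠ 1) (a : Fˣ) (χ : Chi F E c)
variable [(UnitaryGroup.toAdelic F E c 1 (JW F E a)).range.Normal]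

/-- **`χ̃` — Liu's `χ` as a continuous unitary character of the adelic quotient `[U(J_W a)] = U(J_W a)(𝔸_F) ⧸ U(J_W a)(F)`**
(`PontryaginDual`), the descent of `adelicLineChar a χ`: finite component `χ_W`, trivial archimedean component.  This is the
`f = χ` against which [Liu2021, l. 2145] integrates the theta kernel over `[U(W)]`. [cite: Liu2021, Def. 4.11 (l. 2090); proof of Prop. 4.13 (l. 2145)] -/
def chiQuot : PontryaginDual (UnitaryGroup.adelic F E c 1 (JW F E a) ⧸ (UnitaryGroup.toAdelic F E c 1 (JW F E a)).range) where
  toFun q := ⟨((QuotientGroup.lift _ (adelicLineChar F E c a χ.1) (range_toAdelic_le_ker_adelicLineChar F E c a χ.2) q : ℂˣ) : ℂ),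
    mem_sphere_zero_iff_norm.2 (by
      induction q using QuotientGroup.induction_on with
      | H h => rw [QuotientGroup.lift_mk]; exact norm_adelicLineChar F E c h2 hc a χ h)⟩
  map_one' := Circle.ext (by
    change ((QuotientGroup.lift _ (adelicLineChar F E c a χ.1) _ 1 : ℂˣ) : ℂ) = ((1 : Circle) : ℂ)
    rw [map_one, Units.val_one, Circle.coe_one])
  map_mul' p q := Circle.ext (by
    change ((QuotientGroup.lift _ (adelicLineChar F E c a χ.1) _ (p * q) : ℂˣ) : ℂ) =
      ((QuotientGroup.lift _ (adelicLineChar F E c a χ.1) _ p : ℂˣ) : ℂ) *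
        ((QuotientGroup.lift _ (adelicLineChar F E c a χ.1) _ q : ℂˣ) : ℂ)
    rw [map_mul, Units.val_mul])
  continuous_toFun := by
    refine Continuous.subtype_mk ?_ _
    refine Units.continuous_val.comp ?_
    change Continuous (QuotientGroup.lift _ (adelicLineChar F E c a χ.1)
      (range_toAdelic_le_ker_adelicLineChar F E c a χ.2))
    rw [(QuotientGroup.isQuotientMap_mk _).continuous_iff]
    exact continuous_adelicLineChar F E c a χ.2.1

/-- **`χ̃([h]) = χ_W(h_f)`**, values in `ℂ`. [cite: Liu2021, Def. 4.11 (l. 2090); App. D §D.1 Step 3 (l. 5221)] -/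
@[simp] theorem coe_chiQuot_mk (h : UnitaryGroup.adelic F E c 1 (JW F E a)) :
    ((chiQuot F E c h2 hc a χ (QuotientGroup.mk h) : Circle) : ℂ) =
      ((lineChar F E c a χ.1 (UnitaryGroup.finPart F E c 1 (JW F E a) h) : ℂˣ) : ℂ) := rfl

/-- `χ̃` read through `charCM` (the currency of `ThetaKernelDatum.thetaLift_act_right_charCM` /
`Li1992/RallisInnerProductCharacterLift`): `charCM χ̃ [h] = χ_W(h_f)`. [cite: Liu2021, proof of Prop. 4.13 (l. 2145)] -/
theorem charCM_chiQuot_mk (h : UnitaryGroup.adelic F E c 1 (JW F E a)) :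
    charCM (chiQuot F E c h2 hc a χ) (QuotientGroup.mk h) =
      ((lineChar F E c a χ.1 (UnitaryGroup.finPart F E c 1 (JW F E a) h) : ℂˣ) : ℂ) := rfl

/-- **archimedean triviality**: `χ̃([(h_∞, 1)]) = 1`. [cite: BorelJacquet1979, §4.1] -/
theorem coe_chiQuot_mk_archToAdelic (x : UnitaryGroup.arch F E c 1 (JW F E a)) :
    ((chiQuot F E c h2 hc a χ (QuotientGroup.mk (UnitaryGroup.archToAdelic F E c 1 (JW F E a) x)) : Circle) : ℂ) = 1 := by
  rw [coe_chiQuot_mk, UnitaryGroup.finPart_archToAdelic, map_one, Units.val_one]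

/-- finite part: `χ̃([(1, h_f)]) = χ_W(h_f)`. [cite: Liu2021, App. D §D.1 Step 3 (l. 5221)] -/
theorem coe_chiQuot_mk_finAdelicToAdelic (b : UnitaryGroup.finAdelic F E c 1 (JW F E a)) :
    ((chiQuot F E c h2 hc a χ (QuotientGroup.mk (UnitaryGroup.finAdelicToAdelic F E c 1 (JW F E a) b)) : Circle) : ℂ) =
      ((lineChar F E c a χ.1 b : ℂˣ) : ℂ) := by
  rw [coe_chiQuot_mk, UnitaryGroup.finPart_finAdelicToAdelic]

/-- **the weight identity `hχw` of `Li1992/ThetaLiftCharacterArchFinReduction`** with `χ_∞ = 1`, `w_f = conj ∘ χ_W`: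
`conj χ̃([h]) = conj 1 · conj χ_W(h_f)`. [cite: Liu2021, proof of Prop. 4.13 (l. 2145)] -/
theorem conj_coe_chiQuot_mk (h : UnitaryGroup.adelic F E c 1 (JW F E a)) :
    conj ((chiQuot F E c h2 hc a χ (QuotientGroup.mk h) : Circle) : ℂ) =
      conj ((fun _ : UnitaryGroup.arch F E c 1 (JW F E a) => (1 : ℂ)) (UnitaryGroup.archPart F E c 1 (JW F E a) h)) *
        conj ((lineChar F E c a χ.1 (UnitaryGroup.finPart F E c 1 (JW F E a) h) : ℂˣ) : ℂ) := by
  rw [coe_chiQuot_mk, map_one, one_mul]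

end Quot

end Literature.NumberTheory.Automorphic.Liu2021.Def411WeilCarriers

end
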